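import Literature.NumberTheory.Sieve.HeathBrownCubicPrimesOutline
import Literature.NumberTheory.Sieve.HeathBrownCubicPrimesProofs
import Literature.NumberTheory.LFunctions.PrimeIdealTheorem
import Literature.NumberTheory.LFunctions.PrimeIdealTheoremProofs
import Literature.NumberTheory.LFunctions.PrimeIdealChebyshev
import Literature.NumberTheory.LFunctions.DegreeOnePrimes
import HarnessLib

/-!
# Heath-Brown's (2.3) for `ℚ(2^{1/3})` from the prime ideal theorem; parity.S18 from two facts

Proof layer under `Sieve/HeathBrownCubicPrimesOutline.lean` (D-0014: this file is sorry-free and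
contains only theorems).  It discharges the named fact `HeathBrown2001_firstDegreePIT`
(Heath-Brown, Acta Math. 186 (2001), display (2.3), first-degree form) from the GENERAL prime
ideal theorem with de la Vallée-Poussin error term, `Literature.NumberTheory.LFunctions.NumberField.primeIdealTheorem`
(Landau 1903; a named fact of `LFunctions/PrimeIdealTheorem.lean`), exactly as the paper does
("By the Prime Ideal Theorem we have …", p. 5), and assembles

* `HeathBrown2001_firstDegreePIT_of_primeIdealTheorem : primeIdealTheorem → firstDegreePIT`;
* `setOf_prime_cube_add_two_mul_cube_infinite_of_primeIdealTheorem :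
    primeIdealTheorem → HeathBrown2001_sieveComparison → parity.S18`;
* **`HeathBrown2001_firstDegreePIT_holds : HeathBrown2001_firstDegreePIT`** — the DISCHARGE of
  (2.3), unconditionally, feeding the tree's proof of the prime ideal theorem
  (`Literature.NumberTheory.LFunctions.NumberField.primeIdealTheorem_holds`,
  `LFunctions/PrimeIdealTheoremProofs.lean`: Landau's method, proved for every number field) into
  `HeathBrown2001_firstDegreePIT_of_primeIdealTheorem`;
* `HeathBrown2001_primePairCount_asymptotic_of_sieveComparison`,
  `setOf_prime_cube_add_two_mul_cube_infinite_of_sieveComparison` — (2.4) alone ⇒ (2.2) ⇒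
  parity.S18.

After this file the vendored statement parity.S18 (`Literature.NumberTheory.Sieve.setOf_prime_cube_add_two_mul_cube_infinite`)
rests, through the outline of §2, on exactly ONE named fact: Heath-Brown's sieve comparison (2.4)
(`HeathBrown2001_sieveComparison`, the content of §§3–13 of the paper); the prime ideal theorem
(2.3) (`HeathBrown2001_firstDegreePIT_holds`, from `primeIdealTheorem_holds`) and the singular
product (`HeathBrown2001_singularProduct_holds`) are theorems.

## The argument (p. 5 of the paper, made explicit)

For `K = ℚ[X]/(X³ − 2)` (modelled as `AdjoinRoot`, as in
`DegreeOnePrimes.exists_card_absNorm_eq_prime_eq_rootCount`):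
`π_K(x) = ∑_{p ≤ x} G(p) + #{P : N P ≤ x, N P not prime}` (`primeIdealCount_eq_sum_add_card`),
where `G(p)` is the number of prime ideals of norm `p`.  (i) The second term is at most
`[K:ℚ](√x + 1)` (`card_filter_not_prime_absNorm_le`: such `P` lie over primes `q ≤ √x`, at most
`[K:ℚ]` over each).  (ii) By Dedekind–Kummer, `G(p) = ν_p = #{n mod p : n³ ≡ 2}` for all primes
`p` not dividing the conductor exponent `e` of `2^{1/3}`
(`DegreeOnePrimes.exists_card_absNorm_eq_prime_eq_rootCount`), and `|G(p) − ν_p| ≤ 2^{[K:ℚ]} + 3`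
always; so `|π_K(x) − π⁽¹⁾_K(x)| ≤ (2^{[K:ℚ]}+3)(e+1) + [K:ℚ](√x+1)`, which is absorbed into
`x exp(−c √log x)` because `x exp(−c√log x) ≥ e^{−c²} √x` and `≥ e^{−c²}`.
(In fact `e = 1`, i.e. `𝓞_K = ℤ[2^{1/3}]` — `LFunctions/CubeRootTwoField.lean` — but the
argument here does not need it.)

## References

* D. R. Heath-Brown, *Primes represented by `x³ + 2y³`*, Acta Math. 186 (2001) 1–84, §2,
  displays (2.2)–(2.4). [cite: HeathBrownActa2001, §2 (2.3)]
* E. Landau, *Neuer Beweis des Primzahlsatzes und Beweis des Primidealsatzes*, Math. Ann. 56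
  (1903) 645–670. [cite: LandauMathAnn1903, Primidealsatz]
-/

noncomputable section

open Filter Finset Polynomial NumberField Topology

namespace Literature.NumberTheory.Sieve.CubicPrimes

section NumberField

variable {K : Type*} [Field K] [NumberField K]

/-- For a prime `p`, Landau's `G(p)` (the number of prime ideals of `𝓞 K` of norm `p`) is the
number of all ideals of norm `p`: an ideal of prime norm is a nonzero prime. [folklore] -/
theorem normPrimeIdealCount_eq_card_of_prime {p : ℕ} (hp : p.Prime) :
    Literature.NumberTheory.LFunctions.NumberField.normPrimeIdealCount K p =
      Nat.card {I : Ideal (𝓞 K) // Ideal.absNorm I = p} := by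
  rw [Literature.NumberTheory.LFunctions.NumberField.normPrimeIdealCount,
    show Nat.card {I : Ideal (𝓞 K) // Ideal.absNorm I = p} =
      ({I : Ideal (𝓞 K) | Ideal.absNorm I = p} : Set (Ideal (𝓞 K))).ncard from
      Nat.card_coe_set_eq _]
  congr 1
  ext I
  simp only [Set.mem_setOf_eq]
  constructor
  · rintro ⟨-, -, h⟩
    exact h
  · intro h
    refine ⟨Ideal.isPrime_of_irreducible_absNorm (by rw [h]; exact hp), fun h0 => ?_, h⟩
    rw [h0, Ideal.absNorm_bot] at h
    exact hp.ne_zero h.symm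

/-- Every nonzero prime `P` of `𝓞 K` has norm a prime power `q^f` with `f ≥ 1` and lies over
the rational prime `q`. [folklore] -/
theorem exists_absNorm_eq_prime_pow {P : Ideal (𝓞 K)} (hP : P.IsPrime) (hP0 : P ≠ ⊥) :
    ∃ q f : ℕ, q.Prime ∧ 0 < f ∧ Ideal.absNorm P = q ^ f ∧
      P ∈ (Ideal.span {(q : ℤ)}).primesOver (𝓞 K) := by
  classical
  have hn0 : Ideal.absNorm P ≠ 0 := fun h => hP0 (Ideal.absNorm_eq_zero_iff.mp h)
  have hn1 : Ideal.absNorm P ≠ 1 := fun h => hP.ne_top (Ideal.absNorm_eq_one_iff.mp h)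
  have hn2 : 2 ≤ Ideal.absNorm P := by omega
  have hmem : ((Ideal.absNorm P : ℕ) : 𝓞 K) ∈ P := Ideal.absNorm_mem P
  rw [Nat.prod_primeFactors_pow_factorization hn0, Nat.cast_prod] at hmem
  haveI := hP
  obtain ⟨q, hq, hqP⟩ := Ideal.IsPrime.prod_mem_iff.1 hmem
  rw [Nat.cast_pow] at hqP
  have hqprime : q.Prime := Nat.prime_of_mem_primeFactors hq
  have hqP' : (q : 𝓞 K) ∈ P := hP.mem_of_pow_mem _ hqP
  have hdvd : Ideal.absNorm P ∣ q ^ Module.finrank ℚ K := by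
    rw [← Literature.NumberTheory.LFunctions.IdealNormCount.absNorm_span_natCast K q]
    exact Ideal.absNorm_dvd_absNorm_of_le ((Ideal.span_singleton_le_iff_mem _).2 hqP')
  obtain ⟨f, -, hnf⟩ := (Nat.dvd_prime_pow hqprime).1 hdvd
  have hf0 : 0 < f := by
    rcases Nat.eq_zero_or_pos f with rfl | h
    · rw [pow_zero] at hnf; omega
    · exact h
  exact ⟨q, f, hqprime, hf0, hnf, Literature.NumberTheory.LFunctions.IdealNormCount.mem_primesOver_of_mem_normalizedFactors
    hqprime hnf ((Ideal.mem_normalizedFactors_iff hP0).2 ⟨hP, le_rfl⟩)⟩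

/-- **The prime ideals of degree `≥ 2` are few**: among the nonzero prime ideals of `𝓞 K` of norm
`≤ x`, those whose norm is not a rational prime (i.e. of residue degree `≥ 2`) number at most
`[K:ℚ] (√x + 1)` (each lies over a rational prime `q ≤ √x`, and at most `[K:ℚ]` primes lie over
each `q`). [folklore] -/
theorem card_filter_not_prime_absNorm_le (x : ℝ) :
    ((((Literature.NumberTheory.LFunctions.NumberField.finite_primeIdealsLE K x).toFinset.filter
        fun P => ¬ (Ideal.absNorm P).Prime).card : ℕ) : ℝ) ≤
      Module.finrank ℚ K * (Real.sqrt x + 1) := by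
  classical
  set d : ℕ := Module.finrank ℚ K with hd
  set S := (Literature.NumberTheory.LFunctions.NumberField.finite_primeIdealsLE K x).toFinset.filter
    fun P => ¬ (Ideal.absNorm P).Prime with hS
  have key : ∀ P ∈ S, ∃ q f : ℕ, q.Prime ∧ 2 ≤ f ∧ Ideal.absNorm P = q ^ f ∧
      P ∈ (Ideal.span {(q : ℤ)}).primesOver (𝓞 K) ∧ (Ideal.absNorm P).minFac = q ∧
      (q : ℝ) ≤ Real.sqrt x := by
    intro P hP
    rw [hS, mem_filter, Set.Finite.mem_toFinset] at hP
    obtain ⟨⟨hPp, hP0, hPx⟩, hnp⟩ := hP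
    obtain ⟨q, f, hq, hf, hnf, hover⟩ := exists_absNorm_eq_prime_pow hPp hP0
    have hf2 : 2 ≤ f := by
      by_contra h
      have h1 : f = 1 := by omega
      rw [h1, pow_one] at hnf
      exact hnp (hnf ▸ hq)
    refine ⟨q, f, hq, hf2, hnf, hover, by rw [hnf, hq.pow_minFac (by omega)], ?_⟩
    have h1 : (q : ℝ) ^ 2 ≤ x := by
      have h2 : q ^ 2 ≤ q ^ f := Nat.pow_le_pow_right hq.pos hf2
      calc (q : ℝ) ^ 2 = ((q ^ 2 : ℕ) : ℝ) := by push_cast; ring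
        _ ≤ ((q ^ f : ℕ) : ℝ) := by exact_mod_cast h2
        _ = (Ideal.absNorm P : ℝ) := by rw [hnf]
        _ ≤ x := hPx
    calc (q : ℝ) = Real.sqrt ((q : ℝ) ^ 2) := by rw [Real.sqrt_sq (Nat.cast_nonneg _)]
      _ ≤ Real.sqrt x := Real.sqrt_le_sqrt h1
  -- fibres of `P ↦ minFac (N P)` have at most `d` elements
  have hfib : ∀ b ∈ S.image (fun P => (Ideal.absNorm P).minFac),
      (S.filter fun P => (Ideal.absNorm P).minFac = b).card ≤ d := by
    intro b hb
    obtain ⟨P₀, hP₀, rfl⟩ := mem_image.1 hb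
    obtain ⟨q, f, hq, -, -, -, hmin, -⟩ := key P₀ hP₀
    rw [hmin]
    have hsub : ((S.filter fun P => (Ideal.absNorm P).minFac = q : Finset (Ideal (𝓞 K))) :
        Set (Ideal (𝓞 K))) ⊆ (Ideal.span {(q : ℤ)}).primesOver (𝓞 K) := by
      intro P hP
      rw [Finset.coe_filter] at hP
      obtain ⟨hPS, hPq⟩ := hP
      obtain ⟨q', f', -, -, -, hover', hmin', -⟩ := key P hPS
      rw [hmin'] at hPq
      subst hPq
      exact hover'
    haveI := Fact.mk hq
    haveI : (Ideal.span {(q : ℤ)}).IsMaximal := Int.ideal_span_isMaximal_of_prime q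
    have hfin : ((Ideal.span {(q : ℤ)}).primesOver (𝓞 K)).Finite :=
      IsDedekindDomain.primesOver_finite _ _
    calc (S.filter fun P => (Ideal.absNorm P).minFac = q).card
        = (((S.filter fun P => (Ideal.absNorm P).minFac = q : Finset (Ideal (𝓞 K))) :
            Set (Ideal (𝓞 K)))).ncard := by rw [Set.ncard_coe_finset]
      _ ≤ ((Ideal.span {(q : ℤ)}).primesOver (𝓞 K)).ncard := Set.ncard_le_ncard hsub hfin
      _ = Nat.card ((Ideal.span {(q : ℤ)}).primesOver (𝓞 K)) := (Nat.card_coe_set_eq _).symm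
      _ ≤ d := Literature.NumberTheory.LFunctions.IdealNormCount.card_primesOver_le K hq
  have hcard : S.card ≤ d * (S.image fun P => (Ideal.absNorm P).minFac).card :=
    Finset.card_le_mul_card_image S d hfib
  have himg : (S.image fun P => (Ideal.absNorm P).minFac).card ≤ ⌊Real.sqrt x⌋₊ + 1 := by
    calc (S.image fun P => (Ideal.absNorm P).minFac).card ≤ (Iic ⌊Real.sqrt x⌋₊).card := by
          refine card_le_card fun b hb => ?_
          obtain ⟨P, hP, rfl⟩ := mem_image.1 hb
          obtain ⟨q, f, -, -, -, -, hmin, hqx⟩ := key P hP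
          rw [mem_Iic, hmin]
          exact Nat.le_floor hqx
      _ = ⌊Real.sqrt x⌋₊ + 1 := Nat.card_Iic _
  calc ((S.card : ℕ) : ℝ) ≤ ((d * (⌊Real.sqrt x⌋₊ + 1) : ℕ) : ℝ) := by
        exact_mod_cast hcard.trans (Nat.mul_le_mul_left d himg)
    _ = d * ((⌊Real.sqrt x⌋₊ : ℝ) + 1) := by push_cast; ring
    _ ≤ d * (Real.sqrt x + 1) := by gcongr; exact Nat.floor_le (Real.sqrt_nonneg x)

/-- `π_K(x) = ∑_{p ≤ x} G(p) + #{P : N P ≤ x, N P not prime}` for `x ≥ 0`: the prime ideals of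
norm `≤ x` split into those of prime norm, counted fibrewise over the primes `p ≤ x`, and the
rest. [folklore] -/
theorem primeIdealCount_eq_sum_add_card {x : ℝ} (hx : 0 ≤ x) :
    Literature.NumberTheory.LFunctions.NumberField.primeIdealCount K x =
      ∑ p ∈ (Iic ⌊x⌋₊).filter Nat.Prime, Literature.NumberTheory.LFunctions.NumberField.normPrimeIdealCount K p +
        ((Literature.NumberTheory.LFunctions.NumberField.finite_primeIdealsLE K x).toFinset.filter
          fun P => ¬ (Ideal.absNorm P).Prime).card := by
  classical
  set T := (Literature.NumberTheory.LFunctions.NumberField.finite_primeIdealsLE K x).toFinset with hT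
  rw [Literature.NumberTheory.LFunctions.NumberField.primeIdealCount,
    Set.ncard_eq_toFinset_card _ (Literature.NumberTheory.LFunctions.NumberField.finite_primeIdealsLE K x), ← hT,
    ← Finset.card_filter_add_card_filter_not (s := T) fun P => (Ideal.absNorm P).Prime]
  congr 1
  rw [Finset.card_eq_sum_card_fiberwise (f := fun P => Ideal.absNorm P)
    (t := (Iic ⌊x⌋₊).filter Nat.Prime) ?_]
  · refine sum_congr rfl fun p hp => ?_
    rw [mem_filter, mem_Iic] at hp
    rw [← Literature.NumberTheory.LFunctions.NumberField.card_filter_primeIdealsLE_absNorm_eq (K := K) (x := x) (n := p)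
      ((Nat.le_floor_iff hx).1 hp.1), ← hT]
    congr 1
    ext P
    simp only [mem_filter]
    constructor
    · rintro ⟨⟨h1, -⟩, h2⟩
      exact ⟨h1, h2⟩
    · rintro ⟨h1, h2⟩
      exact ⟨⟨h1, h2 ▸ hp.2⟩, h2⟩
  · intro P hP
    simp only [Finset.mem_coe, mem_filter, hT, Set.Finite.mem_toFinset,
      Literature.NumberTheory.LFunctions.NumberField.primeIdealsLE, Set.mem_setOf_eq, mem_Iic] at hP ⊢
    exact ⟨Nat.le_floor hP.1.2.2, hP.2⟩

end NumberField

/-! ### (2.3) for `ℚ(2^{1/3})` from the prime ideal theorem -/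

/-- **`HeathBrown2001_firstDegreePIT` (Heath-Brown (2.3), first-degree form) follows from the
prime ideal theorem with de la Vallée-Poussin error term** (`Literature.NumberTheory.LFunctions.NumberField.primeIdealTheorem`,
Landau 1903) applied to `K = ℚ[X]/(X³ − 2)`: `π_K(x) − π⁽¹⁾_K(x)` consists of (i) the primes of
degree `≥ 2`, at most `[K:ℚ](√x + 1)` (`card_filter_not_prime_absNorm_le`), and (ii) the
discrepancy `G(p) − ν_p` at the finitely many primes `p` dividing the Dedekind–Kummer exponent
`e` of `2^{1/3}` (`Literature.NumberTheory.LFunctions.DegreeOnePrimes.exists_card_absNorm_eq_prime_eq_rootCount`: `G(p) = ν_p`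
for `p ∤ e`), bounded by `(2^{[K:ℚ]} + 3)(e + 1)`; both are `≤ const · x exp(−c√log x)` since
`x exp(−c√log x) ≥ e^{−c²} x^{3/4}`. [cite: HeathBrownActa2001, §2 (2.3)]
[cite: LandauMathAnn1903, Primidealsatz] -/
theorem HeathBrown2001_firstDegreePIT_of_primeIdealTheorem
    (hPIT : Literature.NumberTheory.LFunctions.NumberField.primeIdealTheorem) : HeathBrown2001_firstDegreePIT := by
  classical
  set g : ℤ[X] := X ^ 3 - C 2 with hg_def
  have hg : g.Monic := monic_X_pow_sub_C 2 three_ne_zero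
  have hirr : Irreducible g := irreducible_X_pow_three_sub_C_two
  haveI : Fact (Irreducible (g.map (algebraMap ℤ ℚ))) :=
    ⟨Literature.NumberTheory.LFunctions.DegreeOnePrimes.irreducible_map_rat hg hirr⟩
  set K := AdjoinRoot (g.map (algebraMap ℤ ℚ)) with hK
  obtain ⟨c, hc, C, hC⟩ := hPIT K
  obtain ⟨e, he, hcount⟩ := Literature.NumberTheory.LFunctions.DegreeOnePrimes.exists_card_absNorm_eq_prime_eq_rootCount hg hirr
  set d : ℕ := Module.finrank ℚ K with hd
  set B : ℝ := (2 : ℝ) ^ d + 3 with hB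
  -- `G(p) = ν_p` off `e`, and `|G(p) − ν_p| ≤ B` always
  have hG : ∀ p : ℕ, p.Prime → ¬ p ∣ e →
      (Literature.NumberTheory.LFunctions.NumberField.normPrimeIdealCount K p : ℝ) = cubeRootTwoCount p := by
    intro p hp hpe
    rw [normPrimeIdealCount_eq_card_of_prime hp, hcount p hp hpe,
      cubeRootTwoCount_eq_polyRootCountMod, polyRootCountMod_single]
  have hGB : ∀ p : ℕ, p.Prime →
      |(Literature.NumberTheory.LFunctions.NumberField.normPrimeIdealCount K p : ℝ) - cubeRootTwoCount p| ≤ B := by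
    intro p hp
    have h1 : (Literature.NumberTheory.LFunctions.NumberField.normPrimeIdealCount K p : ℝ) ≤ 2 ^ d := by
      rw [normPrimeIdealCount_eq_card_of_prime hp]
      exact LFunctions.idealNormCount_prime_le K hp
    have h2 : (cubeRootTwoCount p : ℝ) ≤ 3 := by exact_mod_cast cubeRootTwoCount_le_three hp
    have h3 : (0 : ℝ) ≤ Literature.NumberTheory.LFunctions.NumberField.normPrimeIdealCount K p := Nat.cast_nonneg _
    have h4 : (0 : ℝ) ≤ cubeRootTwoCount p := Nat.cast_nonneg _
    rw [abs_le]
    constructor <;> linarith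
  refine ⟨c, hc, C + (B * (e + 1) + 2 * d) * Real.exp (c ^ 2), fun x hx => ?_⟩
  set N := ⌊x⌋₊ with hN
  set L := Real.log x with hL
  have hx0 : 0 < x := by linarith
  have hx1 : 1 ≤ x := by linarith
  -- (a) the difference `π_K(x) − π⁽¹⁾_K(x)`
  set S := (Literature.NumberTheory.LFunctions.NumberField.finite_primeIdealsLE K x).toFinset.filter
    fun P => ¬ (Ideal.absNorm P).Prime with hS
  have hScard : ((S.card : ℕ) : ℝ) ≤ d * (Real.sqrt x + 1) := card_filter_not_prime_absNorm_le x
  have hsum : |∑ p ∈ (Iic N).filter Nat.Prime,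
      ((Literature.NumberTheory.LFunctions.NumberField.normPrimeIdealCount K p : ℝ) - cubeRootTwoCount p)| ≤ B * (e + 1) := by
    have hzero : ∀ p ∈ (Iic N).filter Nat.Prime, p ∉ ((Iic N).filter Nat.Prime).filter (· ∣ e) →
        ((Literature.NumberTheory.LFunctions.NumberField.normPrimeIdealCount K p : ℝ) - cubeRootTwoCount p) = 0 := by
      intro p hp hpe
      have hp' := (mem_filter.1 hp).2
      have hne : ¬ p ∣ e := fun h => hpe (mem_filter.2 ⟨hp, h⟩)
      rw [hG p hp' hne, sub_self]
    rw [← Finset.sum_subset (filter_subset (· ∣ e) ((Iic N).filter Nat.Prime)) hzero]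
    calc |∑ p ∈ ((Iic N).filter Nat.Prime).filter (· ∣ e),
          ((Literature.NumberTheory.LFunctions.NumberField.normPrimeIdealCount K p : ℝ) - cubeRootTwoCount p)|
        ≤ ∑ p ∈ ((Iic N).filter Nat.Prime).filter (· ∣ e),
          |(Literature.NumberTheory.LFunctions.NumberField.normPrimeIdealCount K p : ℝ) - cubeRootTwoCount p| :=
          abs_sum_le_sum_abs _ _
      _ ≤ ∑ p ∈ ((Iic N).filter Nat.Prime).filter (· ∣ e), B :=
          sum_le_sum fun p hp => hGB p (mem_filter.1 (mem_filter.1 hp).1).2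
      _ = B * (((Iic N).filter Nat.Prime).filter (· ∣ e)).card := by
          rw [sum_const, nsmul_eq_mul, mul_comm]
      _ ≤ B * (e + 1) := by
          have hB0 : 0 ≤ B := by positivity
          have hc' : (((Iic N).filter Nat.Prime).filter (· ∣ e)).card ≤ e + 1 := by
            calc (((Iic N).filter Nat.Prime).filter (· ∣ e)).card ≤ (Iic e).card := by
                  refine card_le_card fun p hp => ?_
                  rw [mem_filter] at hp
                  exact mem_Iic.2 (Nat.le_of_dvd he hp.2)
              _ = e + 1 := Nat.card_Iic e
          have : ((((Iic N).filter Nat.Prime).filter (· ∣ e)).card : ℝ) ≤ e + 1 := by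
            exact_mod_cast hc'
          exact mul_le_mul_of_nonneg_left this hB0
  have hdiff : |(Literature.NumberTheory.LFunctions.NumberField.primeIdealCount K x : ℝ) - firstDegreePrimeCount x| ≤
      B * (e + 1) + d * (Real.sqrt x + 1) := by
    rw [primeIdealCount_eq_sum_add_card (K := K) hx0.le, firstDegreePrimeCount_def, Nat.cast_add,
      Nat.cast_sum, Nat.cast_sum, ← hN, ← hS]
    have e1 : ∑ p ∈ (Iic N).filter Nat.Prime, (Literature.NumberTheory.LFunctions.NumberField.normPrimeIdealCount K p : ℝ) +
        (S.card : ℝ) - ∑ p ∈ (Iic N).filter Nat.Prime, (cubeRootTwoCount p : ℝ) =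
        ∑ p ∈ (Iic N).filter Nat.Prime,
          ((Literature.NumberTheory.LFunctions.NumberField.normPrimeIdealCount K p : ℝ) - cubeRootTwoCount p) + (S.card : ℝ) := by
      rw [Finset.sum_sub_distrib]; ring
    rw [e1]
    calc _ ≤ |∑ p ∈ (Iic N).filter Nat.Prime,
          ((Literature.NumberTheory.LFunctions.NumberField.normPrimeIdealCount K p : ℝ) - cubeRootTwoCount p)| + |(S.card : ℝ)| :=
          abs_add_le _ _
      _ ≤ B * (e + 1) + d * (Real.sqrt x + 1) := add_le_add hsum (by rw [Nat.abs_cast]; exact hScard)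
  -- (b) absorb the elementary error into `x exp(−c√log x)`
  have hL0 : 0 ≤ L := Real.log_nonneg hx1
  have hxexp : Real.exp L = x := Real.exp_log hx0
  have hsq : Real.sqrt L ^ 2 = L := Real.sq_sqrt hL0
  have hcs : c * Real.sqrt L ≤ L / 4 + c ^ 2 := by nlinarith [sq_nonneg (Real.sqrt L / 2 - c)]
  have hE : x * Real.exp (-c * Real.sqrt L) = Real.exp (L - c * Real.sqrt L) := by
    rw [sub_eq_add_neg, Real.exp_add, hxexp]; ring_nf
  have hsqrtx : Real.sqrt x = Real.exp (L / 2) := by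
    rw [← hxexp, show Real.exp L = Real.exp (L / 2) ^ 2 by rw [sq, ← Real.exp_add]; ring_nf,
      Real.sqrt_sq (Real.exp_pos _).le]
  have hk1 : Real.sqrt x ≤ Real.exp (c ^ 2) * (x * Real.exp (-c * Real.sqrt L)) := by
    rw [hE, ← Real.exp_add, hsqrtx]
    exact Real.exp_le_exp.2 (by nlinarith)
  have hk2 : (1 : ℝ) ≤ Real.exp (c ^ 2) * (x * Real.exp (-c * Real.sqrt L)) := by
    rw [hE, ← Real.exp_add]
    exact Real.one_le_exp (by nlinarith)
  have hB0 : 0 ≤ B * (e + 1) := by positivity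
  have hd0 : (0 : ℝ) ≤ d := Nat.cast_nonneg _
  have habsorb : B * (e + 1) + d * (Real.sqrt x + 1) ≤
      (B * (e + 1) + 2 * d) * Real.exp (c ^ 2) * (x * Real.exp (-c * Real.sqrt L)) := by
    set W := Real.exp (c ^ 2) * (x * Real.exp (-c * Real.sqrt L)) with hW
    calc B * (e + 1) + d * (Real.sqrt x + 1)
        = B * (e + 1) * 1 + d * Real.sqrt x + d * 1 := by ring
      _ ≤ B * (e + 1) * W + d * W + d * W := by gcongr
      _ = (B * (e + 1) + 2 * d) * Real.exp (c ^ 2) * (x * Real.exp (-c * Real.sqrt L)) := by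
          rw [hW]; ring
  -- (c) conclude
  have htri : |(firstDegreePrimeCount x : ℝ) - LFunctions.offsetLogIntegral x| ≤
      |(Literature.NumberTheory.LFunctions.NumberField.primeIdealCount K x : ℝ) - LFunctions.offsetLogIntegral x| +
        |(Literature.NumberTheory.LFunctions.NumberField.primeIdealCount K x : ℝ) - firstDegreePrimeCount x| := by
    have e2 : (firstDegreePrimeCount x : ℝ) - LFunctions.offsetLogIntegral x =
        ((Literature.NumberTheory.LFunctions.NumberField.primeIdealCount K x : ℝ) - LFunctions.offsetLogIntegral x) -
          ((Literature.NumberTheory.LFunctions.NumberField.primeIdealCount K x : ℝ) - firstDegreePrimeCount x) := by ring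
    rw [e2]
    exact abs_sub _ _
  calc |(firstDegreePrimeCount x : ℝ) - LFunctions.offsetLogIntegral x|
      ≤ C * x * Real.exp (-c * Real.sqrt L) + (B * (e + 1) + d * (Real.sqrt x + 1)) :=
        htri.trans (add_le_add (hC x hx) hdiff)
    _ ≤ C * x * Real.exp (-c * Real.sqrt L) +
        (B * (e + 1) + 2 * d) * Real.exp (c ^ 2) * (x * Real.exp (-c * Real.sqrt L)) := by
        gcongr
    _ = (C + (B * (e + 1) + 2 * d) * Real.exp (c ^ 2)) * x * Real.exp (-c * Real.sqrt L) := by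
        ring

/-! ### Assembly: parity.S18 from the prime ideal theorem and Heath-Brown's (2.4) -/

/-- The quantitative theorem (2.2) from the general prime ideal theorem (Landau) and
Heath-Brown's sieve comparison (2.4); the singular product is discharged
(`HeathBrown2001_singularProduct_holds`). [cite: HeathBrownActa2001, §2 pp. 4–5] -/
theorem HeathBrown2001_primePairCount_asymptotic_of_primeIdealTheorem
    (hPIT : Literature.NumberTheory.LFunctions.NumberField.primeIdealTheorem) (h24 : HeathBrown2001_sieveComparison) :
    HeathBrown2001_primePairCount_asymptotic :=
  HeathBrown2001_primePairCount_asymptotic_of HeathBrown2001_singularProduct_holds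
    (HeathBrown2001_firstDegreePIT_of_primeIdealTheorem hPIT) h24

/-- **parity.S18 from two named facts**: the prime ideal theorem with de la Vallée-Poussin error
term (`Literature.NumberTheory.LFunctions.NumberField.primeIdealTheorem`, Landau 1903) and Heath-Brown's sieve comparison (2.4)
(`HeathBrown2001_sieveComparison`, the content of §§3–13 of the paper) imply that there are
infinitely many primes `x³ + 2y³` with `x, y ≥ 1`. [cite: HeathBrownActa2001, Theorem (p. 2)] -/
theorem _root_.Literature.NumberTheory.Sieve.setOf_prime_cube_add_two_mul_cube_infinite_of_primeIdealTheorem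
    (hPIT : Literature.NumberTheory.LFunctions.NumberField.primeIdealTheorem) (h24 : HeathBrown2001_sieveComparison) :
    Literature.NumberTheory.Sieve.setOf_prime_cube_add_two_mul_cube_infinite :=
  Literature.NumberTheory.Sieve.setOf_prime_cube_add_two_mul_cube_infinite_of_heathBrown2001
    (HeathBrown2001_primePairCount_asymptotic_of_primeIdealTheorem hPIT h24)

/-! ### Discharge of (2.3) and the one-fact frontier -/

/-- **Heath-Brown's (2.3) holds: the prime ideal theorem for `K = ℚ(2^{1/3})` with the
de la Vallée-Poussin error term, first-degree form** — "the Prime Ideal Theorem may be stated in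
the form `π_K(x) = Li(x) + O(x exp{−c√(log x)})` (2.3) for a suitable positive constant `c`"
(p. 5), here for `π⁽¹⁾_K(x) = ∑_{p ≤ x} ν_p` (`firstDegreePrimeCount`) with an explicit constant for
`x ≥ 2`: there are `c > 0` and `C` with `|π⁽¹⁾_K(x) − Li(x)| ≤ C x exp(−c√(log x))` for all
`x ≥ 2`.  DISCHARGE of the named fact `HeathBrown2001_firstDegreePIT`: the general prime ideal
theorem is a theorem of the tree (`Literature.NumberTheory.LFunctions.NumberField.primeIdealTheorem_holds`, Landau 1903 /
Montgomery–Vaughan Theorem 8.9, proved for every number field in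
`LFunctions/PrimeIdealTheoremProofs.lean`), and `HeathBrown2001_firstDegreePIT_of_primeIdealTheorem`
specialises it to `ℚ[X]/(X³ − 2)` and passes to first-degree primes (Dedekind–Kummer off the
conductor, `O(√x)` primes of degree `≥ 2`). [cite: HeathBrownActa2001, §2 (2.3), p. 5]
[cite: LandauMathAnn1903, Primidealsatz] -/
theorem HeathBrown2001_firstDegreePIT_holds : HeathBrown2001_firstDegreePIT :=
  HeathBrown2001_firstDegreePIT_of_primeIdealTheorem
    Literature.NumberTheory.LFunctions.NumberField.primeIdealTheorem_holds

/-- **(2.4) alone implies the quantitative theorem (2.2)** ("In order to establish (2.2) it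
therefore suffices to show (2.4)", p. 5), now unconditionally in (2.3) and in the singular
product: `HeathBrown2001_sieveComparison → HeathBrown2001_primePairCount_asymptotic`.
[cite: HeathBrownActa2001, §2 pp. 4–5] -/
theorem HeathBrown2001_primePairCount_asymptotic_of_sieveComparison
    (h24 : HeathBrown2001_sieveComparison) : HeathBrown2001_primePairCount_asymptotic :=
  HeathBrown2001_primePairCount_asymptotic_of HeathBrown2001_singularProduct_holds
    HeathBrown2001_firstDegreePIT_holds h24

/-- **parity.S18 from the single named fact (2.4)**: Heath-Brown's sieve comparison
`π(𝒜) = κ π(ℬ) + O(η²X²(log X)^{−1}(log log X)^{−1/6})` (`HeathBrown2001_sieveComparison`, the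
content of §§3–13) implies that there are infinitely many primes `x³ + 2y³` with `x, y ≥ 1`; the
prime ideal theorem (2.3) and the singular product are discharged in the tree.
[cite: HeathBrownActa2001, Theorem (p. 2) and §2 pp. 4–5] -/
theorem _root_.Literature.NumberTheory.Sieve.setOf_prime_cube_add_two_mul_cube_infinite_of_sieveComparison
    (h24 : HeathBrown2001_sieveComparison) :
    Literature.NumberTheory.Sieve.setOf_prime_cube_add_two_mul_cube_infinite :=
  Literature.NumberTheory.Sieve.setOf_prime_cube_add_two_mul_cube_infinite_of_heathBrown2001
    (HeathBrown2001_primePairCount_asymptotic_of_sieveComparison h24)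

end Literature.NumberTheory.Sieve.CubicPrimes

end
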